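import Literature.NumberTheory.GaloisRepresentations.AlgebraicHeckeCharacterGrossencharakterProofs
import Literature.NumberTheory.GaloisRepresentations.HeckeCharacterOfRayClass
import HarnessLib

/-!
# Weil's theorem: the `Aut(ℂ)`-conjugates `^σχ` of an algebraic Hecke character

Topic `NumberTheory/GaloisRepresentations`, namespace
`Literature.NumberTheory.GaloisRepresentations`; sequel of
`AlgebraicHeckeCharacterGrossencharakterProofs` (the tree's vocabulary for Weil's type `A₀`:
`HeckeCharacter.IsAlgebraic`, `HeckeCharacter.HasInfinityType χ p q`, the archimedean factor
`HeckeCharacter.archFactor p q`).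

**Weil 1956** (*On a certain type of characters of the idèle-class group*, §1; the case `n = 1`
of Clozel 1990, Thm. 3.13, and of Patrikis 2019, §2.1–2.4): an algebraic Hecke character `χ` of
infinity type `(p, q)` — `χ((x, 1)) = ∏_w ι_w(x_w)^{-p_w} \overline{ι_w(x_w)}^{-q_w}` near `1` — has,
for EVERY automorphism `σ` of `ℂ`, a conjugate `^σχ`: the Hecke character with
`(^σχ)(x) = σ(χ(x))` on the ideles `x` with `x_∞ = 1` (in particular `(^σχ)(ϖ_v) = σ(χ(ϖ_v))` at
every finite place) and infinity type `^σ(p, q)`, the exponent of the embedding `φ : K → ℂ` in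
`^σ(p, q)` being the exponent of `σ⁻¹ ∘ φ` in `(p, q)` (`HeckeCharacter.autConjType`).

Construction (no connectedness, no algebraicity of the values is needed): let
`A = A_{p,q} ∘ (·)_∞ : 𝕀_K → ℂˣ`; by the infinity type and a module of definition
(`HeckeCharacter.exists_isModulus`) the character `B = χ · A⁻¹` is trivial on a neighbourhood of
`1`, so `σ ∘ B` is again a continuous character; put `^σχ = (σ ∘ B) · A_{^σ(p,q)} ∘ (·)_∞`.
Triviality on `Kˣ`: `B((k)) = A((k)_∞)⁻¹ = (∏_φ φ(k)^{-n_φ})⁻¹` and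
`σ(∏_φ φ(k)^{-n_φ}) = ∏_{φ'} φ'(k)^{-n_{σ⁻¹φ'}} = A_{^σ(p,q)}((k)_∞)` — the only place where the
type is used (`prod_embedding_zpow_eq`, `map_prod_embedding_zpow`, `map_archFactor_globalToInfiniteUnits`).

## Main statements

* `HeckeCharacter.embExponent p q φ` (def) — the exponent `n_φ` of the embedding `φ` in the type
  `(p, q)` (`p_w + q_w` at a real place; `p_w` for `φ = σ_w`, `q_w` for `φ = σ̄_w` at a complex one);
  `HeckeCharacter.autConjType σ p q` (def) — the conjugate type `^σ(p, q)`.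
* `archFactor_globalToInfiniteUnits_eq_prod_embeddings` — `A_{p,q}((k)_∞) = ∏_φ φ(k)^{-n_φ}`.
* `HeckeCharacter.infPart`, `archIdeleChar p q` (`x ↦ A_{p,q}(x_∞)`, continuous), `unitaryRatio χ p q`
  (`B = χ A⁻¹`, trivial near `1`: `HasInfinityType.eventually_unitaryRatio_eq_one`), `autConjHom`,
  and the Hecke character **`HasInfinityType.autConj h σ = ^σχ`** (defs);
* **`HeckeCharacter.HasInfinityType.exists_autConj`** — Weil's theorem as above; with
  `HasInfinityType.hasInfinityType_autConj`, `autConj_apply_of_fst_eq_one`, `localComponent_autConj`,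
  `valueAtUniformizer_autConj` (`(^σχ)(ϖ_v) = σ(χ(ϖ_v))`), `isUnramifiedAt_autConj_iff`, and
  `IsAlgebraic.exists_autConj`.

## References

* A. Weil, *On a certain type of characters of the idèle-class group of an algebraic
  number-field*, Proc. Int. Symp. Tokyo–Nikko 1955 (1956), 1–7, §1. [Weil1956]
* J.-P. Serre, *Abelian ℓ-adic representations and elliptic curves* (1968), Ch. II §2.4.
  [SerreAbelianLadic1968]
* L. Clozel, *Motifs et formes automorphes*, in Automorphic forms, Shimura varieties, and
  L-functions I (1990), §1 and Thm. 3.13 (`n = 1`). [Clozel1990]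
* S. Patrikis, *Variations on a theorem of Tate*, Mem. AMS 258 (2019), §2.1–2.4. [Patrikis2019]
-/

noncomputable section

open scoped NumberField Topology ComplexConjugate Classical
open NumberField IsDedekindDomain Filter NumberField.InfinitePlace NumberField.InfinitePlace.Completion

namespace Literature.NumberTheory.GaloisRepresentations

universe u

variable {K : Type u} [Field K] [NumberField K]

/-! ### §1. Exponents of embeddings and the conjugate type -/

namespace HeckeCharacter

omit [NumberField K] in
/-- The **exponent of the embedding `φ : K → ℂ`** in the infinity type `(p, q)`: at a real place
`w = InfinitePlace.mk φ` the archimedean factor is `ι_w(x)^{-p_w} ι_w(x)^{-q_w}` (`ι_w` real), so `n_φ = p_w + q_w`;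
at a complex place the embedding `σ_w = w.embedding` carries `p_w` and its conjugate carries `q_w`.
(Weil 1956, §1: the type of `χ` as an element of `ℤ[Hom(K, ℂ)]`.) [cite: Weil1956, §1] -/
def embExponent (p q : InfinitePlace K → ℤ) (φ : K →+* ℂ) : ℤ :=
  if ComplexEmbedding.IsReal φ then p (InfinitePlace.mk φ) + q (InfinitePlace.mk φ)
  else if φ = (InfinitePlace.mk φ).embedding then p (InfinitePlace.mk φ) else q (InfinitePlace.mk φ)

omit [NumberField K] in
/-- The type `(p, q)` attached to an exponent function `n` on the embeddings: `p_w = n_{σ_w}` and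
`q_w = n_{σ̄_w}` at a complex place, `q_w = 0` at a real one. [folklore] -/
def typeOfExponent (n : (K →+* ℂ) → ℤ) : (InfinitePlace K → ℤ) × (InfinitePlace K → ℤ) :=
  (fun w ↦ n w.embedding,
    fun w ↦ if w.IsReal then 0 else n (ComplexEmbedding.conjugate w.embedding))

omit [NumberField K] in
/-- The exponents of the type attached to `n` are `n`. [folklore] -/
theorem embExponent_typeOfExponent (n : (K →+* ℂ) → ℤ) (φ : K →+* ℂ) :
    embExponent (typeOfExponent n).1 (typeOfExponent n).2 φ = n φ := by
  unfold embExponent typeOfExponent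
  by_cases hφ : ComplexEmbedding.IsReal φ
  · have hw : (InfinitePlace.mk φ).IsReal := ⟨φ, hφ, rfl⟩
    simp only [hφ, if_true, hw, embedding_mk_eq_of_isReal hφ, add_zero]
  · have hw : ¬ (InfinitePlace.mk φ).IsReal := by
      rw [isReal_iff]
      rcases embedding_mk_eq φ with h | h
      · rwa [h]
      · rwa [h, ComplexEmbedding.isReal_conjugate_iff]
    by_cases he : φ = (InfinitePlace.mk φ).embedding
    · simp only [hφ, if_false, he.symm, if_true]
    · simp only [hφ, if_false, he, hw]
      rcases embedding_mk_eq φ with h | h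
      · exact absurd h.symm he
      · rw [h, ComplexEmbedding.involutive_conjugate K φ]

/-- The **conjugate infinity type `^σ(p, q)`** under `σ ∈ Aut(ℂ) = (ℂ ≃ₐ[ℚ] ℂ)`: the exponent of
the embedding `φ` in `^σ(p, q)` is the exponent of `σ⁻¹ ∘ φ` in `(p, q)` (Weil 1956, §1;
Clozel 1990, Thm. 3.13: the type of `^σπ` is `^σ` of the type of `π`; Patrikis 2019, §2.4,
`^σM = (μ_{σ⁻¹ι})_ι`). [cite: Weil1956, §1] -/
def autConjType (σ : ℂ ≃ₐ[ℚ] ℂ) (p q : InfinitePlace K → ℤ) :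
    (InfinitePlace K → ℤ) × (InfinitePlace K → ℤ) :=
  typeOfExponent fun φ ↦ embExponent p q ((σ.symm : ℂ ≃ₐ[ℚ] ℂ).toAlgHom.toRingHom.comp φ)

omit [NumberField K] in
/-- The exponents of `^σ(p, q)`: `n^σ_φ = n_{σ⁻¹ ∘ φ}`. [folklore] -/
theorem embExponent_autConjType (σ : ℂ ≃ₐ[ℚ] ℂ) (p q : InfinitePlace K → ℤ) (φ : K →+* ℂ) :
    embExponent (autConjType σ p q).1 (autConjType σ p q).2 φ =
      embExponent p q ((σ.symm : ℂ ≃ₐ[ℚ] ℂ).toAlgHom.toRingHom.comp φ) :=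
  embExponent_typeOfExponent _ φ

/-! ### §2. The archimedean factor on principal ideles as a product over the embeddings -/

/-- The fibre of `mk` over `w`: the embeddings inducing `w` are `σ_w` and `σ̄_w` (equal iff `w` is
real). [folklore] -/
theorem filter_mk_eq (w : InfinitePlace K) :
    (Finset.univ.filter fun φ : K →+* ℂ ↦ InfinitePlace.mk φ = w) =
      {w.embedding, ComplexEmbedding.conjugate w.embedding} := by
  ext φ
  simp only [Finset.mem_filter, Finset.mem_univ, true_and, Finset.mem_insert,
    Finset.mem_singleton]
  rw [← mk_embedding w, mk_eq_iff, mk_embedding]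
  constructor
  · rintro (h | h)
    · exact Or.inl h
    · right
      rw [← h, ComplexEmbedding.involutive_conjugate K φ]
  · rintro (h | h)
    · exact Or.inl h
    · right
      rw [h, ComplexEmbedding.involutive_conjugate K w.embedding]

/-- **`∏_w σ_w(k)^{-p_w} \overline{σ_w(k)}^{-q_w} = ∏_φ φ(k)^{-n_φ}`**: the archimedean factor of a
principal idele as a product over all complex embeddings, with the exponents `embExponent`.
[cite: Weil1956, §1] -/
theorem prod_embedding_zpow_eq (p q : InfinitePlace K → ℤ) {k : K} (hk : k ≠ 0) :
    (∏ w : InfinitePlace K, w.embedding k ^ (-p w) * conj (w.embedding k) ^ (-q w)) =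
      ∏ φ : K →+* ℂ, φ k ^ (-embExponent p q φ) := by
  rw [← Finset.prod_fiberwise Finset.univ (fun φ : K →+* ℂ ↦ InfinitePlace.mk φ)
    (fun φ : K →+* ℂ ↦ φ k ^ (-embExponent p q φ))]
  refine Finset.prod_congr rfl fun w _ ↦ ?_
  rw [filter_mk_eq]
  by_cases hw : w.IsReal
  · -- one real embedding, `conj (σ_w k) = σ_w k`
    have hreal : ComplexEmbedding.IsReal w.embedding := isReal_iff.mp hw
    have hconj : ComplexEmbedding.conjugate w.embedding = w.embedding :=
      conjugate_embedding_eq_of_isReal hw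
    have hck : conj (w.embedding k) = w.embedding k := by
      rw [← ComplexEmbedding.conjugate_coe_eq, hconj]
    rw [hconj, Finset.pair_eq_singleton, Finset.prod_singleton, hck, ← zpow_add₀ (by simpa using hk)]
    unfold embExponent
    rw [if_pos hreal, mk_embedding, neg_add]
  · have hne : w.embedding ≠ ComplexEmbedding.conjugate w.embedding := by
      intro h
      exact hw (isReal_iff.mpr (ComplexEmbedding.isReal_iff.mpr h.symm))
    have hnr : ¬ ComplexEmbedding.IsReal w.embedding := fun h ↦ hw (isReal_iff.mpr h)
    have hnr' : ¬ ComplexEmbedding.IsReal (ComplexEmbedding.conjugate w.embedding) := by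
      rwa [ComplexEmbedding.isReal_conjugate_iff]
    rw [Finset.prod_pair hne]
    unfold embExponent
    rw [if_neg hnr, mk_embedding, if_pos rfl, if_neg hnr', mk_conjugate_eq, mk_embedding,
      if_neg hne.symm, ComplexEmbedding.conjugate_coe_eq]

/-- The archimedean factor of a principal infinite idele as a product over the embeddings:
`A_{p,q}((k)_∞) = ∏_φ φ(k)^{-n_φ}`. [cite: Weil1956, §1] -/
theorem archFactor_globalToInfiniteUnits_eq_prod_embeddings (p q : InfinitePlace K → ℤ) (k : Kˣ) :
    archFactor p q (globalToInfiniteUnits K k) = ∏ φ : K →+* ℂ, φ (k : K) ^ (-embExponent p q φ) := by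
  rw [archFactor_globalToInfiniteUnits, prod_embedding_zpow_eq p q k.ne_zero]

/-- **`σ(∏_φ φ(k)^{-n_φ}) = ∏_φ φ(k)^{-n_{σ⁻¹φ}}`**: an automorphism of `ℂ` permutes the embeddings
`K → ℂ` (`φ ↦ σ ∘ φ`). This is why `^σχ` is again trivial on `Kˣ`. [cite: Weil1956, §1] -/
theorem map_prod_embedding_zpow (σ : ℂ ≃ₐ[ℚ] ℂ) (n : (K →+* ℂ) → ℤ) (k : K) :
    σ (∏ φ : K →+* ℂ, φ k ^ (-n φ)) =
      ∏ φ : K →+* ℂ, φ k ^ (-n ((σ.symm : ℂ ≃ₐ[ℚ] ℂ).toAlgHom.toRingHom.comp φ)) := by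
  rw [map_prod]
  simp only [map_zpow₀]
  -- reindex by `φ ↦ σ ∘ φ`
  let e : (K →+* ℂ) ≃ (K →+* ℂ) :=
    { toFun := fun φ ↦ (σ : ℂ ≃ₐ[ℚ] ℂ).toAlgHom.toRingHom.comp φ
      invFun := fun φ ↦ (σ.symm : ℂ ≃ₐ[ℚ] ℂ).toAlgHom.toRingHom.comp φ
      left_inv := fun φ ↦ RingHom.ext fun x ↦ by simp
      right_inv := fun φ ↦ RingHom.ext fun x ↦ by simp }
  refine Fintype.prod_equiv e _ _ fun φ ↦ ?_
  have h1 : (σ.symm : ℂ ≃ₐ[ℚ] ℂ).toAlgHom.toRingHom.comp (e φ) = φ := e.left_inv φ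
  rw [h1]
  rfl

/-- **The type identity on `Kˣ`**: `σ(A_{p,q}((k)_∞)) = A_{^σ(p,q)}((k)_∞)` for every `k ∈ Kˣ`.
[cite: Weil1956, §1] -/
theorem map_archFactor_globalToInfiniteUnits (σ : ℂ ≃ₐ[ℚ] ℂ) (p q : InfinitePlace K → ℤ) (k : Kˣ) :
    σ (archFactor p q (globalToInfiniteUnits K k)) =
      archFactor (autConjType σ p q).1 (autConjType σ p q).2 (globalToInfiniteUnits K k) := by
  rw [archFactor_globalToInfiniteUnits_eq_prod_embeddings, map_prod_embedding_zpow,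
    archFactor_globalToInfiniteUnits_eq_prod_embeddings]
  refine Finset.prod_congr rfl fun φ _ ↦ ?_
  rw [embExponent_autConjType]

/-! ### §3. The infinite part of an idele and the archimedean factor as an idele character -/

variable (K) in
/-- The infinite part `𝕀_K → (K ⊗ ℝ)ˣ`, `x ↦ x_∞`, of an idele (companion of
`ideleGroup.finPart`). [folklore] -/
def infPart : ideleGroup K →* (InfiniteAdeleRing K)ˣ :=
  Units.map (RingHom.fst (InfiniteAdeleRing K) (FiniteAdeleRing (𝓞 K) K)).toMonoidHom

/-- `infPart x` is the infinite component `x_∞`. [folklore] -/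
@[simp] theorem val_infPart (x : ideleGroup K) :
    ((infPart K x : (InfiniteAdeleRing K)ˣ) : InfiniteAdeleRing K) = (x : AdeleRing (𝓞 K) K).1 := rfl

/-- The infinite part of an infinite idele `(x, 1)` is `x`. [folklore] -/
@[simp] theorem infPart_infiniteIdeles (x : (InfiniteAdeleRing K)ˣ) :
    infPart K (infiniteIdeles K x) = x :=
  Units.ext rfl

/-- The infinite part of a principal idele is the principal infinite idele. [folklore] -/
@[simp] theorem infPart_principalIdele (k : Kˣ) :
    infPart K (principalIdele K k) = globalToInfiniteUnits K k :=
  Units.ext rfl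

/-- `x = (x_∞, 1) · z` with `z_∞ = 1`: the idele `(x_∞, 1)⁻¹ x` has trivial infinite part and the
finite components of `x`. [folklore] -/
theorem infiniteIdeles_infPart_inv_mul (x : ideleGroup K) :
    (((infiniteIdeles K (infPart K x))⁻¹ * x : ideleGroup K) : AdeleRing (𝓞 K) K).1 = 1 ∧
      ∀ v, (((infiniteIdeles K (infPart K x))⁻¹ * x : ideleGroup K) : AdeleRing (𝓞 K) K).2 v =
        (x : AdeleRing (𝓞 K) K).2 v := by
  constructor
  · rw [ideleGroup_val_fst_mul]
    have h := ideleGroup_val_inv_fst_mul (infiniteIdeles K (infPart K x))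
    rw [infiniteIdeles_fst] at h
    exact h
  · intro v
    rw [ideleGroup_val_snd_mul, ideleGroup_val_inv_snd, infiniteIdeles_snd, inv_one, one_mul]

/-- The infinite part is continuous. [folklore] -/
theorem continuous_infPart : Continuous (infPart K) :=
  Continuous.units_map _ continuous_fst

/-- The archimedean factor never vanishes. [folklore] -/
theorem archFactor_ne_zero (p q : InfinitePlace K → ℤ) (x : (InfiniteAdeleRing K)ˣ) :
    archFactor p q x ≠ 0 := by
  rw [archFactor_apply]
  refine Finset.prod_ne_zero_iff.mpr fun w _ ↦ mul_ne_zero ?_ ?_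
  · exact zpow_ne_zero _ (InfiniteIdele.extensionEmbedding_apply_ne_zero x w)
  · exact zpow_ne_zero _ ((map_ne_zero _).mpr (InfiniteIdele.extensionEmbedding_apply_ne_zero x w))

/-- The archimedean factor is continuous on `(K ⊗ ℝ)ˣ`. [folklore] -/
theorem continuous_archFactor (p q : InfinitePlace K → ℤ) :
    Continuous (archFactor p q : (InfiniteAdeleRing K)ˣ → ℂ) := by
  have h : (archFactor p q : (InfiniteAdeleRing K)ˣ → ℂ) = fun x : (InfiniteAdeleRing K)ˣ ↦
      ∏ w : InfinitePlace K, extensionEmbedding w ((x : InfiniteAdeleRing K) w) ^ (-p w) *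
        conj (extensionEmbedding w ((x : InfiniteAdeleRing K) w)) ^ (-q w) :=
    funext (archFactor_apply p q)
  rw [h]
  refine continuous_finsetProd _ fun w _ ↦ ?_
  have hc : Continuous fun x : (InfiniteAdeleRing K)ˣ ↦ extensionEmbedding w ((x : InfiniteAdeleRing K) w) :=
    (isometry_extensionEmbedding w).continuous.comp ((continuous_apply w).comp Units.continuous_val)
  refine (hc.zpow₀ _ fun x ↦ Or.inl (InfiniteIdele.extensionEmbedding_apply_ne_zero x w)).mul ?_
  exact (Complex.continuous_conj.comp hc).zpow₀ _ fun x ↦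
    Or.inl ((map_ne_zero _).mpr (InfiniteIdele.extensionEmbedding_apply_ne_zero x w))

/-- **The archimedean factor as a character of the ideles**, `x ↦ A_{p,q}(x_∞) ∈ ℂˣ`. [folklore] -/
def archIdeleChar (p q : InfinitePlace K → ℤ) : ideleGroup K →* ℂˣ :=
  ((archFactor p q).comp (infPart K)).toHomUnits

/-- Unfolding `archIdeleChar`. [folklore] -/
@[simp] theorem coe_archIdeleChar_apply (p q : InfinitePlace K → ℤ) (x : ideleGroup K) :
    (archIdeleChar p q x : ℂ) = archFactor p q (infPart K x) := rfl

/-- `A_{p,q}` is continuous as a map `𝕀_K → ℂˣ`. [folklore] -/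
theorem continuous_archIdeleChar (p q : InfinitePlace K → ℤ) :
    Continuous (archIdeleChar (K := K) p q) := by
  have hval : Continuous fun x : ideleGroup K ↦ (archIdeleChar p q x : ℂ) :=
    (continuous_archFactor p q).comp continuous_infPart
  refine Units.continuous_iff.mpr ⟨hval, ?_⟩
  have e : (fun x : ideleGroup K ↦ ((archIdeleChar p q x)⁻¹ : ℂˣ).val) =
      fun x ↦ ((archIdeleChar p q x : ℂ))⁻¹ := by
    funext x
    rw [Units.val_inv_eq_inv_val]
  rw [e]
  exact hval.inv₀ fun x ↦ (archIdeleChar p q x).ne_zero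

/-! ### §4. The conjugate character `^σχ` -/

/-- The auxiliary character `B = χ · A_{p,q}⁻¹ : 𝕀_K → ℂˣ` (trivial near `1` when `χ` has infinity
type `(p, q)`). [folklore] -/
def unitaryRatio (χ : HeckeCharacter K) (p q : InfinitePlace K → ℤ) : ideleGroup K →* ℂˣ :=
  χ.toContinuousMonoidHom.toMonoidHom * (archIdeleChar p q)⁻¹

/-- Unfolding `unitaryRatio`. [folklore] -/
theorem coe_unitaryRatio_apply (χ : HeckeCharacter K) (p q : InfinitePlace K → ℤ) (x : ideleGroup K) :
    (unitaryRatio χ p q x : ℂ) = (χ x : ℂ) * (archFactor p q (infPart K x))⁻¹ := by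
  simp [unitaryRatio, Units.val_inv_eq_inv_val]

/-- **`B = χ · A⁻¹` is trivial on a neighbourhood of `1`** when `χ` has infinity type `(p, q)`: on
`x` with `x_∞` in the neighbourhood of the infinity type, `x_v ∈ 𝒪_vˣ` everywhere and
`x_v ≡ 1 mod 𝔭_v^{e_v}` on a module of definition `(T, e)` (`HeckeCharacter.exists_isModulus`),
`B(x) = B((x_∞,1)) · χ((x_∞,1)⁻¹x) = 1 · 1`. [cite: Weil1956, §1] -/
theorem HasInfinityType.eventually_unitaryRatio_eq_one {χ : HeckeCharacter K}
    {p q : InfinitePlace K → ℤ} (h : χ.HasInfinityType p q) :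
    ∀ᶠ x in 𝓝 (1 : ideleGroup K), unitaryRatio χ p q x = 1 := by
  obtain ⟨U, hU, hχU⟩ := h
  obtain ⟨T, e, hmod⟩ := χ.exists_isModulus
  -- the archimedean condition
  obtain ⟨U₀, hU₀, hU₀U⟩ := Units.exists_nhds_one_val_inv hU
  have h1 : {x : ideleGroup K | (x : AdeleRing (𝓞 K) K).1 ∈ U₀} ∈ 𝓝 (1 : ideleGroup K) :=
    (continuous_fst.comp Units.continuous_val).continuousAt.preimage_mem_nhds hU₀
  have h2 : {x : ideleGroup K | ((x⁻¹ : ideleGroup K) : AdeleRing (𝓞 K) K).1 ∈ U₀} ∈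
      𝓝 (1 : ideleGroup K) := by
    have hc : Continuous fun x : ideleGroup K ↦ ((x⁻¹ : ideleGroup K) : AdeleRing (𝓞 K) K).1 :=
      continuous_fst.comp (Units.continuous_val.comp continuous_inv)
    refine hc.continuousAt.preimage_mem_nhds ?_
    show U₀ ∈ 𝓝 (((1 : ideleGroup K)⁻¹ : ideleGroup K) : AdeleRing (𝓞 K) K).1
    rw [inv_one]
    exact hU₀
  -- the finite conditions
  have h3 : (unitIdeles K : Set (ideleGroup K)) ∈ 𝓝 (1 : ideleGroup K) :=
    (isOpen_unitIdeles K).mem_nhds (unitIdeles K).one_mem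
  have h4 : (⋂ v ∈ T, {x : ideleGroup K |
      Valued.v ((x : AdeleRing (𝓞 K) K).2 v - 1) ≤ WithZero.exp (-(e v : ℤ))}) ∈
        𝓝 (1 : ideleGroup K) := by
    refine (Filter.biInter_finset_mem T).mpr fun v _ ↦ ?_
    have hv : {c : v.adicCompletion K | Valued.v (c - 1) ≤ WithZero.exp (-(e v : ℤ))} ∈
        𝓝 ((fun x : ideleGroup K ↦ (x : AdeleRing (𝓞 K) K).2 v) 1) :=
      Filter.mem_of_superset (adicCompletion_setOf_valued_sub_one_lt_mem_nhds v (e v))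
        fun c (hc : Valued.v (c - 1) < _) ↦ hc.le
    exact (continuous_ideleGroup_snd_apply v).continuousAt.preimage_mem_nhds hv
  filter_upwards [h1, h2, h3, h4] with x hx1 hx2 hx3 hx4
  -- split `x = (x_∞, 1) · z`
  set y : ideleGroup K := infiniteIdeles K (infPart K x) with hy
  set z : ideleGroup K := y⁻¹ * x with hz
  have hxyz : x = y * z := by rw [hz, mul_inv_cancel_left]
  have hyU : infPart K x ∈ U := by
    refine hU₀U _ hx1 ?_
    have e1 : (((infPart K x)⁻¹ : (InfiniteAdeleRing K)ˣ) : InfiniteAdeleRing K) =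
        ((x⁻¹ : ideleGroup K) : AdeleRing (𝓞 K) K).1 := by
      rw [← map_inv]
      rfl
    rw [e1]
    exact hx2
  obtain ⟨hz1, hz2⟩ := infiniteIdeles_infPart_inv_mul x
  have hzχ : χ z = 1 := by
    refine hmod z hz1 (fun v ↦ ?_) (fun v hv ↦ ?_)
    · rw [hz2]
      exact hx3 v
    · rw [hz2]
      exact Set.mem_iInter₂.mp hx4 v hv
  have hz' : infPart K z = 1 := Units.ext hz1
  -- `B(y) = 1` by the infinity type, `B(z) = χ(z) = 1`
  apply Units.ext
  rw [hxyz, map_mul, Units.val_mul, coe_unitaryRatio_apply, coe_unitaryRatio_apply, Units.val_one,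
    infPart_infiniteIdeles, hχU _ hyU, mul_inv_cancel₀ (archFactor_ne_zero p q _), one_mul, hzχ,
    hz', map_one, inv_one, mul_one, Units.val_one]

/-- `σ ∘ B` as a character `𝕀_K → ℂˣ` (continuous because `B` is locally constant). [folklore] -/
def autCompUnitaryRatio (σ : ℂ ≃ₐ[ℚ] ℂ) (χ : HeckeCharacter K) (p q : InfinitePlace K → ℤ) :
    ideleGroup K →* ℂˣ :=
  (Units.map (σ : ℂ ≃ₐ[ℚ] ℂ).toAlgHom.toRingHom.toMonoidHom).comp (unitaryRatio χ p q)

/-- Unfolding `autCompUnitaryRatio`. [folklore] -/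
@[simp] theorem coe_autCompUnitaryRatio_apply (σ : ℂ ≃ₐ[ℚ] ℂ) (χ : HeckeCharacter K)
    (p q : InfinitePlace K → ℤ) (x : ideleGroup K) :
    (autCompUnitaryRatio σ χ p q x : ℂ) = σ (unitaryRatio χ p q x : ℂ) := rfl

/-- The monoid homomorphism underlying `^σχ`: `x ↦ σ(B(x)) · A_{^σ(p,q)}(x_∞)`. [cite: Weil1956, §1] -/
def autConjHom (σ : ℂ ≃ₐ[ℚ] ℂ) (χ : HeckeCharacter K) (p q : InfinitePlace K → ℤ) : ideleGroup K →* ℂˣ :=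
  autCompUnitaryRatio σ χ p q * archIdeleChar (autConjType σ p q).1 (autConjType σ p q).2

/-- Unfolding `autConjHom`. [folklore] -/
theorem coe_autConjHom_apply (σ : ℂ ≃ₐ[ℚ] ℂ) (χ : HeckeCharacter K) (p q : InfinitePlace K → ℤ)
    (x : ideleGroup K) :
    (autConjHom σ χ p q x : ℂ) =
      σ ((χ x : ℂ) * (archFactor p q (infPart K x))⁻¹) *
        archFactor (autConjType σ p q).1 (autConjType σ p q).2 (infPart K x) := by
  rw [autConjHom, MonoidHom.mul_apply, Units.val_mul, coe_autCompUnitaryRatio_apply,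
    coe_unitaryRatio_apply, coe_archIdeleChar_apply]

/-- `autConjHom` is continuous when `χ` has infinity type `(p, q)`: near `1` it agrees with the
continuous `A_{^σ(p,q)}` (`σ ∘ B = 1` there), and a homomorphism of topological groups continuous at
`1` is continuous. [folklore] -/
theorem HasInfinityType.continuous_autConjHom {χ : HeckeCharacter K} {p q : InfinitePlace K → ℤ}
    (h : χ.HasInfinityType p q) (σ : ℂ ≃ₐ[ℚ] ℂ) : Continuous (autConjHom σ χ p q) := by
  refine continuous_of_continuousAt_one (autConjHom σ χ p q) ?_
  have key : (autConjHom σ χ p q : ideleGroup K → ℂˣ) =ᶠ[𝓝 1]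
      fun x ↦ archIdeleChar (autConjType σ p q).1 (autConjType σ p q).2 x := by
    filter_upwards [h.eventually_unitaryRatio_eq_one] with x hx
    rw [autConjHom, MonoidHom.mul_apply, autCompUnitaryRatio, MonoidHom.comp_apply, hx, map_one,
      one_mul]
  exact (continuous_archIdeleChar _ _).continuousAt.congr key.symm

/-- `autConjHom` kills the principal ideles: `χ((k)) = 1` and
`σ(A_{p,q}((k)_∞)) = A_{^σ(p,q)}((k)_∞)` (`map_archFactor_globalToInfiniteUnits`). [cite: Weil1956, §1] -/
theorem autConjHom_principalIdele (σ : ℂ ≃ₐ[ℚ] ℂ) (χ : HeckeCharacter K) (p q : InfinitePlace K → ℤ)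
    (k : Kˣ) : autConjHom σ χ p q (principalIdele K k) = 1 := by
  apply Units.ext
  rw [coe_autConjHom_apply, χ.map_principal (principalIdele_mem k), Units.val_one, one_mul,
    infPart_principalIdele, map_inv₀, map_archFactor_globalToInfiniteUnits,
    inv_mul_cancel₀ (archFactor_ne_zero _ _ _)]

/-- **The conjugate `^σχ` of a Hecke character of infinity type `(p, q)`** (Weil 1956): the Hecke
character `x ↦ σ(χ(x) A_{p,q}(x_∞)⁻¹) · A_{^σ(p,q)}(x_∞)`. [cite: Weil1956, §1] -/
def HasInfinityType.autConj {χ : HeckeCharacter K} {p q : InfinitePlace K → ℤ}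
    (h : χ.HasInfinityType p q) (σ : ℂ ≃ₐ[ℚ] ℂ) : HeckeCharacter K where
  toContinuousMonoidHom :=
    { autConjHom σ χ p q with continuous_toFun := h.continuous_autConjHom σ }
  map_principal' := by
    rintro x ⟨k, rfl⟩
    exact autConjHom_principalIdele σ χ p q k

/-- Unfolding `autConj`. [folklore] -/
theorem HasInfinityType.autConj_apply {χ : HeckeCharacter K} {p q : InfinitePlace K → ℤ}
    (h : χ.HasInfinityType p q) (σ : ℂ ≃ₐ[ℚ] ℂ) (x : ideleGroup K) :
    (h.autConj σ x : ℂ) =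
      σ ((χ x : ℂ) * (archFactor p q (infPart K x))⁻¹) *
        archFactor (autConjType σ p q).1 (autConjType σ p q).2 (infPart K x) :=
  coe_autConjHom_apply σ χ p q x

/-! ### §5. Weil's theorem -/

/-- **`^σχ = σ ∘ χ` on the ideles with trivial infinite part** (`A(1) = 1`). [cite: Weil1956, §1] -/
theorem HasInfinityType.autConj_apply_of_fst_eq_one {χ : HeckeCharacter K} {p q : InfinitePlace K → ℤ}
    (h : χ.HasInfinityType p q) (σ : ℂ ≃ₐ[ℚ] ℂ) {x : ideleGroup K} (hx : (x : AdeleRing (𝓞 K) K).1 = 1) :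
    (h.autConj σ x : ℂ) = σ (χ x : ℂ) := by
  have hx' : infPart K x = 1 := Units.ext hx
  rw [h.autConj_apply, hx', map_one, map_one, inv_one, mul_one, mul_one]

/-- **`^σχ` has infinity type `^σ(p, q)`**: near `1`, `σ(B((x,1))) = 1`. [cite: Weil1956, §1] -/
theorem HasInfinityType.hasInfinityType_autConj {χ : HeckeCharacter K} {p q : InfinitePlace K → ℤ}
    (h : χ.HasInfinityType p q) (σ : ℂ ≃ₐ[ℚ] ℂ) :
    (h.autConj σ).HasInfinityType (autConjType σ p q).1 (autConjType σ p q).2 := by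
  obtain ⟨U, hU, hχU⟩ := h
  refine ⟨U, hU, fun x hx ↦ ?_⟩
  rw [HasInfinityType.autConj_apply, infPart_infiniteIdeles, hχU x hx,
    mul_inv_cancel₀ (archFactor_ne_zero p q x), map_one, one_mul]

/-- **Weil 1956, §1: the `Aut(ℂ)`-conjugates of an algebraic Hecke character.** If the Hecke
character `χ` of the number field `K` has infinity type `(p, q)`
(`χ((x,1)) = ∏_w ι_w(x_w)^{-p_w} \overline{ι_w(x_w)}^{-q_w}` near `1`), then for every `σ ∈ Aut(ℂ)`
there is a Hecke character `χ'` of infinity type `^σ(p, q)` (`HeckeCharacter.autConjType`: the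
exponent of `φ` is that of `σ⁻¹ ∘ φ`) with `χ'(x) = σ(χ(x))` for every idele `x` with `x_∞ = 1` —
the character `^σχ` (Clozel 1990, Thm. 3.13 for `n = 1`; Patrikis 2019, §2.4). [cite: Weil1956, §1] -/
theorem HasInfinityType.exists_autConj {χ : HeckeCharacter K} {p q : InfinitePlace K → ℤ}
    (h : χ.HasInfinityType p q) (σ : ℂ ≃ₐ[ℚ] ℂ) :
    ∃ χ' : HeckeCharacter K, χ'.HasInfinityType (autConjType σ p q).1 (autConjType σ p q).2 ∧
      ∀ x : ideleGroup K, (x : AdeleRing (𝓞 K) K).1 = 1 → (χ' x : ℂ) = σ (χ x : ℂ) :=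
  ⟨h.autConj σ, h.hasInfinityType_autConj σ, fun _ hx ↦ h.autConj_apply_of_fst_eq_one σ hx⟩

/-- **Local components of `^σχ`**: `(^σχ)_v = σ ∘ χ_v` at every finite place. [cite: Weil1956, §1] -/
theorem HasInfinityType.localComponent_autConj {χ : HeckeCharacter K} {p q : InfinitePlace K → ℤ}
    (h : χ.HasInfinityType p q) (σ : ℂ ≃ₐ[ℚ] ℂ) (v : HeightOneSpectrum (𝓞 K)) (u : (v.adicCompletion K)ˣ) :
    ((h.autConj σ).localComponent v u : ℂ) = σ (χ.localComponent v u : ℂ) := by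
  rw [localComponent_apply, localComponent_apply, h.autConj_apply_of_fst_eq_one σ (localUnits_fst v u)]

/-- **`(^σχ)(ϖ_v) = σ(χ(ϖ_v))`** at every finite place `v`. [cite: Weil1956, §1] -/
theorem HasInfinityType.valueAtUniformizer_autConj {χ : HeckeCharacter K} {p q : InfinitePlace K → ℤ}
    (h : χ.HasInfinityType p q) (σ : ℂ ≃ₐ[ℚ] ℂ) (v : HeightOneSpectrum (𝓞 K)) :
    (h.autConj σ).valueAtUniformizer v = σ (χ.valueAtUniformizer v) :=
  h.localComponent_autConj σ v _

/-- `^σχ` is unramified at `v` iff `χ` is. [cite: Weil1956, §1] -/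
theorem HasInfinityType.isUnramifiedAt_autConj_iff {χ : HeckeCharacter K} {p q : InfinitePlace K → ℤ}
    (h : χ.HasInfinityType p q) (σ : ℂ ≃ₐ[ℚ] ℂ) (v : HeightOneSpectrum (𝓞 K)) :
    (h.autConj σ).IsUnramifiedAt v ↔ χ.IsUnramifiedAt v := by
  constructor <;> intro hv u
  · have e := h.localComponent_autConj σ v
      (Units.map ↑(HeightOneSpectrum.adicCompletionIntegers K v).subtype u)
    rw [hv u, Units.val_one] at e
    -- `σ (χ_v u) = 1`
    have e2 : (χ.localComponent v
        (Units.map ↑(HeightOneSpectrum.adicCompletionIntegers K v).subtype u) : ℂ) = 1 :=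
      σ.injective (by rw [map_one]; exact e.symm)
    exact Units.ext e2
  · apply Units.ext
    rw [h.localComponent_autConj, hv u, Units.val_one, map_one]

/-- **The conjugates of an algebraic Hecke character are algebraic.** [cite: Weil1956, §1] -/
theorem IsAlgebraic.exists_autConj {χ : HeckeCharacter K} (hχ : χ.IsAlgebraic) (σ : ℂ ≃ₐ[ℚ] ℂ) :
    ∃ χ' : HeckeCharacter K, χ'.IsAlgebraic ∧
      (∀ x : ideleGroup K, (x : AdeleRing (𝓞 K) K).1 = 1 → (χ' x : ℂ) = σ (χ x : ℂ)) ∧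
      ∀ v, χ'.valueAtUniformizer v = σ (χ.valueAtUniformizer v) := by
  obtain ⟨p, q, h⟩ := (isAlgebraic_iff_exists_hasInfinityType χ).mp hχ
  exact ⟨h.autConj σ, (isAlgebraic_iff_exists_hasInfinityType _).mpr ⟨_, _, h.hasInfinityType_autConj σ⟩,
    fun _ hx ↦ h.autConj_apply_of_fst_eq_one σ hx, h.valueAtUniformizer_autConj σ⟩

end HeckeCharacter

end Literature.NumberTheory.GaloisRepresentations
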